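import Summits.QuantumFields.YangMills.Theorems.UnitScaleTiltProp7HermiteCornerBlendCov
import HarnessLib

/-!
# Route `UnitScaleTilt`, crux K1 «MinimiserStabilityRegPr» (stmt-QuantumFields-19200), route-R E′ path (α′), row LEMMA-H-CURVED — FILE 4 (abstract energy):
# FROM THE MASTER POINTWISE BOUND TO THE LAPLACIAN ENERGY OF THE CORNER BLEND, WITH DISPLAYED FRAME ROWS AND WEIGHT MASSES

Cell `ym3-torus`, D-0154 (3c) twin-width seat `ym-routeR-w1` (gen 5); row "routeR-w1 g5: LEMMA-H-CURVED" (namer ★ym-ust-19200-p1 g14, 2026-08-28 17:33Z; design of record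
(x2′-corner), contract v2 18:49Z).  THEOREMS ONLY (0 `def`, 0 `sorry`); `--supports stmt-QuantumFields-19200`, count-neutral.  YM₃ on T³ is a ladder rung (R3), not the
Clay problem; nothing here claims a stub, the crux, d = 4 or the mass gap.

WHAT.  On the abstract carrier of ✓ `Prop7HermiteCornerBlendCov` (sites `S`, directions `ι`, shifts `T`, bi-contractive background `U`, centres `Y`, weights `W_y` with
`Σ_y W_y ≡ 1`, `W ≥ 0`, bi-contractive corner frames `P_y`, data `m_y` with central parts `c_y`) the corner blend `Φ(z) = Σ_y W_y(z)·R(P_y z) m_y` satisfies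
  `Σ_z ‖Δ_U Φ(z)‖² ≤ [3(2|ι|(a₁ + 2a₀²))²K₀ + 48|ι|²a₀²G₁K₁]·Σ_y ‖m_y − c_y‖² + 3|ι|²G₂K₂·Σ_y G_y²`
given (rows, all displayed as hypotheses): frame holonomy rows `‖h_(y,μ)(z) − 1‖ ≤ a₀`, `‖h_(y,μ)(z) − h_(y,μ)(z − e_μ)‖ ≤ a₁` on a support predicate `N y z` off which
`W_y` vanishes at `z, z ± e_μ`; a data row `‖R(P_y z)m_y − Z_μ(z)‖ ≤ G_y` on `N` (any recentring `Z`); weight masses in `y` (`Σ_y|∂_μW_y(z)| ≤ G₁`, `Σ_y|Δ²_μW_y(z)| ≤ G₂`)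
and in `z` (`Σ_z W_y ≤ K₀`, `Σ_z|∂_μW_y| ≤ K₁`, `Σ_z|Δ²_μW_y| ≤ K₂`).  With the C¹ cardinal weights (✓ `Prop7HermiteCardinalWeights{,Mass,Columns}`: `G₁ = 6∕ℓ`, `G₂ = 24∕ℓ²`,
`K₀ = ℓ^d`, `K₁ = 6ℓ^(d−1)`, `K₂ = 24ℓ^(d−2)`) and (3.35)-type frame rows `a₀ ≈ e∕ℓ`, `a₁ ≈ e∕ℓ²` every term is `O(ℓ^(d−4))` — `k`-uniform after F-H1's factor `ℓ` in `d = 3`.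

HOW.  §1 scalar inequalities (Jensen, weighted Cauchy–Schwarz for single and double sums); §2 the first-order frame rows recentred at a central `c`
(`D_U(R(P)m) = D_U(R(P)(m − c))`); §3 ★★ `norm_lap_cornerBlend_le_rows`: the master bound ✓ `norm_lap_cornerBlend_le` with the three groups estimated by the rows
(second-order symmetric-pair row ✓ `Prop7ConjFrameTransport.norm_covDstar_covD_conjFrame_le_pair`, first-order rows, data row); §4 the three energy sums and ★★★
`sum_sq_norm_lap_cornerBlend_le`.
HONEST SCOPE.  Abstract bookkeeping; the T³ dictionary (frames from (3.35) cube gauges, data row from coarse covariant differences, F-H1) is the next file.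

References: T. Bałaban, CMP 99 (1985) 389–434 [Balaban1985BackgroundPropagators] ((3.3)-(3.4) pp.390-391, (3.35) p.396); CMP 95 (1984) 17–40 [Balaban1984PropagatorsI]
((1.29)-(1.31) p.23).
-/

set_option autoImplicit false

noncomputable section

open scoped BigOperators

namespace Summit.QuantumFields.YangMills.Theorems.Prop7HermiteCornerBlendEnergy

open Literature.MathematicalPhysics.QuantumFieldTheory.Balaban1983to89
open B9Eq39Adjoint (R R_def R_sub covD covDstar divB)
open Summit.QuantumFields.YangMills.Theorems.Prop7ConjFrameTransport (covD_conjFrame covDstar_conjFrame R_sub_self_eq_of_commute norm_covD_conjFrame_le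
  norm_covDstar_conjFrame_le norm_covDstar_covD_conjFrame_le_pair)
open Summit.QuantumFields.YangMills.Theorems.Prop7HermiteCornerBlendCov (norm_lap_cornerBlend_le)

/-! ## §1 Scalar inequalities -/

section Scalar

/-- weighted Cauchy–Schwarz: `(Σ w·b)² ≤ (Σ w)·(Σ w·b²)` for `w ≥ 0`. [folklore] -/
theorem wcs {β : Type*} (s : Finset β) (w b : β → ℝ) (hw : ∀ i ∈ s, 0 ≤ w i) :
    (∑ i ∈ s, w i * b i) ^ 2 ≤ (∑ i ∈ s, w i) * ∑ i ∈ s, w i * b i ^ 2 :=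
  Finset.sum_sq_le_sum_mul_sum_of_sq_le_mul s hw (fun i hi => mul_nonneg (hw i hi) (sq_nonneg _)) fun i _ => le_of_eq (by ring)

/-- Jensen for a probability weight: `(Σ w·b)² ≤ Σ w·b²` when `w ≥ 0`, `Σ w = 1`. [folklore] -/
theorem jensen_sq {Y : Type*} [Fintype Y] (w b : Y → ℝ) (hw : ∀ y, 0 ≤ w y) (h1 : ∑ y, w y = 1) :
    (∑ y, w y * b y) ^ 2 ≤ ∑ y, w y * b y ^ 2 := by
  have h := wcs Finset.univ w b fun y _ => hw y
  rwa [h1, one_mul] at h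

/-- weighted Cauchy–Schwarz for a double sum. [folklore] -/
theorem wcs2 {α β : Type*} [Fintype α] [Fintype β] (w b : α → β → ℝ) (hw : ∀ i j, 0 ≤ w i j) :
    (∑ i, ∑ j, w i j * b i j) ^ 2 ≤ (∑ i, ∑ j, w i j) * ∑ i, ∑ j, w i j * b i j ^ 2 := by
  have e1 := Fintype.sum_prod_type' (fun i j => w i j * b i j)
  have e2 := Fintype.sum_prod_type' (fun i j => w i j)
  have e3 := Fintype.sum_prod_type' (fun i j => w i j * b i j ^ 2)
  rw [← e1, ← e2, ← e3]
  exact wcs Finset.univ (fun q : α × β => w q.1 q.2) (fun q => b q.1 q.2) fun q _ => hw q.1 q.2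

end Scalar

/-! ## §2 First-order frame rows recentred at a central element -/

section Central

variable {𝔸 : Type*} [Ring 𝔸] {S : Type*} {ι : Type*} (T : ι → Equiv.Perm S) (U : ι → S → 𝔸ˣ)

/-- `D_U(R(P)m)(x,μ) = D_U(R(P)(m − c))(x,μ)` for central `c`. [folklore] -/
theorem covD_conjFrame_central (P : S → 𝔸ˣ) (m c : 𝔸) (hc : ∀ a : 𝔸, Commute c a) (μ : ι) (x : S) :
    covD T U μ (fun z => R (P z) m) x = covD T U μ (fun z => R (P z) (m - c)) x := by
  rw [covD_conjFrame, covD_conjFrame, R_sub_self_eq_of_commute _ m c (hc _)]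

/-- `D*_U(R(P)m)(x,μ) = D*_U(R(P)(m − c))(x,μ)` for central `c`. [folklore] -/
theorem covDstar_conjFrame_central (P : S → 𝔸ˣ) (m c : 𝔸) (hc : ∀ a : 𝔸, Commute c a) (μ : ι) (x : S) :
    covDstar T U μ (fun z => R (P z) m) x = covDstar T U μ (fun z => R (P z) (m - c)) x := by
  rw [covDstar_conjFrame, covDstar_conjFrame, R_sub_self_eq_of_commute _ m c (hc _)]

variable {𝔸 : Type} [NormedRing 𝔸] {S : Type*} {ι : Type*} (T : ι → Equiv.Perm S) (U : ι → S → 𝔸ˣ)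

/-- first-order row with the central part removed: `‖D_U(R(P)m)(x,μ)‖ ≤ 2‖h_μ(x) − 1‖·‖m − c‖`. [cite: Balaban1985BackgroundPropagators, (3.3) p.390] -/
theorem norm_covD_conjFrame_le_central {P : S → 𝔸ˣ} (hP : ∀ z : S, ‖(P z : 𝔸)‖ ≤ 1 ∧ ‖(((P z)⁻¹ : 𝔸ˣ) : 𝔸)‖ ≤ 1)
    (hU : ∀ (κ : ι) (z : S), ‖(U κ z : 𝔸)‖ ≤ 1 ∧ ‖(((U κ z)⁻¹ : 𝔸ˣ) : 𝔸)‖ ≤ 1) (m c : 𝔸) (hc : ∀ a : 𝔸, Commute c a) (μ : ι) (x : S) :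
    ‖covD T U μ (fun z => R (P z) m) x‖ ≤ 2 * ‖(((P x)⁻¹ * U μ x * P (T μ x) : 𝔸ˣ) : 𝔸) - 1‖ * ‖m - c‖ := by
  rw [covD_conjFrame_central T U P m c hc]
  exact norm_covD_conjFrame_le T U hP hU (m - c) μ x

/-- adjoint first-order row with the central part removed: `‖D*_U(R(P)m)(x,μ)‖ ≤ 2‖h_μ(x − e_μ) − 1‖·‖m − c‖`. [cite: Balaban1985BackgroundPropagators, (3.3) p.390] -/
theorem norm_covDstar_conjFrame_le_central {P : S → 𝔸ˣ} (hP : ∀ z : S, ‖(P z : 𝔸)‖ ≤ 1 ∧ ‖(((P z)⁻¹ : 𝔸ˣ) : 𝔸)‖ ≤ 1)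
    (hU : ∀ (κ : ι) (z : S), ‖(U κ z : 𝔸)‖ ≤ 1 ∧ ‖(((U κ z)⁻¹ : 𝔸ˣ) : 𝔸)‖ ≤ 1) (m c : 𝔸) (hc : ∀ a : 𝔸, Commute c a) (μ : ι) (x : S) :
    ‖covDstar T U μ (fun z => R (P z) m) x‖
      ≤ 2 * ‖(((P ((T μ).symm x))⁻¹ * U μ ((T μ).symm x) * P x : 𝔸ˣ) : 𝔸) - 1‖ * ‖m - c‖ := by
  rw [covDstar_conjFrame_central T U P m c hc]
  exact norm_covDstar_conjFrame_le T U hP hU (m - c) μ x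

end Central

/-! ## §3 The master bound with displayed rows -/

section Rows

variable {𝔸 : Type} [NormedRing 𝔸] [NormedAlgebra ℝ 𝔸] {S : Type*} {ι : Type*} [Fintype ι] (T : ι → Equiv.Perm S) (U : ι → S → 𝔸ˣ)
  {Y : Type*} [Fintype Y]

/-- ★★ **THE MASTER BOUND WITH ROWS**: for weights `W ≥ 0` with `Σ_y W_y ≡ 1`, bi-contractive frames and background, frame rows `a₀` (holonomy size) and `a₁` (holonomy
backward difference) on the support predicate `N` (off which `W_y` vanishes at `x` and `x ± e_μ`), central parts `c_y`, and a data row `‖R(P_y x)m_y − Z_μ‖ ≤ G_y` on `N`: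
`‖Δ_UΦ(x)‖ ≤ 2|ι|(a₁ + 2a₀²)·Σ_y W_y(x)‖m_y − c_y‖ + 2a₀·Σ_y Σ_μ (|∂⁻_μW_y(x)| + |∂⁺_μW_y(x)|)‖m_y − c_y‖ + Σ_μ Σ_y |Δ²_μW_y(x)|·G_y`.
[cite: Balaban1985BackgroundPropagators, (3.3)-(3.4) pp.390-391, (3.35) p.396] -/
theorem norm_lap_cornerBlend_le_rows
    (hU : ∀ (κ : ι) (z : S), ‖(U κ z : 𝔸)‖ ≤ 1 ∧ ‖(((U κ z)⁻¹ : 𝔸ˣ) : 𝔸)‖ ≤ 1)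
    (W : Y → S → ℝ) (hW1 : ∀ z : S, ∑ y, W y z = 1) (hW0 : ∀ y z, 0 ≤ W y z)
    (P : Y → S → 𝔸ˣ) (hP : ∀ y z, ‖(P y z : 𝔸)‖ ≤ 1 ∧ ‖(((P y z)⁻¹ : 𝔸ˣ) : 𝔸)‖ ≤ 1)
    (m c : Y → 𝔸) (hc : ∀ y (a : 𝔸), Commute (c y) a)
    (N : Y → S → Prop) (hN : ∀ y z, ¬ N y z → W y z = 0 ∧ (∀ μ, W y (T μ z) = 0) ∧ (∀ μ, W y ((T μ).symm z) = 0))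
    (a₀ a₁ : ℝ)
    (hA : ∀ y z, N y z → ∀ μ, ‖(((P y z)⁻¹ * U μ z * P y (T μ z) : 𝔸ˣ) : 𝔸) - 1‖ ≤ a₀
      ∧ ‖(((P y ((T μ).symm z))⁻¹ * U μ ((T μ).symm z) * P y z : 𝔸ˣ) : 𝔸) - 1‖ ≤ a₀
      ∧ ‖(((P y z)⁻¹ * U μ z * P y (T μ z) : 𝔸ˣ) : 𝔸) - (((P y ((T μ).symm z))⁻¹ * U μ ((T μ).symm z) * P y z : 𝔸ˣ) : 𝔸)‖ ≤ a₁)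
    (x : S) (Z : ι → 𝔸) (G : Y → ℝ) (hG : ∀ y, N y x → ∀ μ, ‖R (P y x) (m y) - Z μ‖ ≤ G y) :
    ‖divB T U (fun μ => covD T U μ (fun z => ∑ y, W y z • R (P y z) (m y))) x‖
      ≤ 2 * (Fintype.card ι) * (a₁ + 2 * a₀ ^ 2) * ∑ y, W y x * ‖m y - c y‖
        + 2 * a₀ * ∑ y, ∑ μ, (|W y x - W y ((T μ).symm x)| + |W y (T μ x) - W y x|) * ‖m y - c y‖
        + ∑ μ, ∑ y, |(W y (T μ x) - W y x) - (W y x - W y ((T μ).symm x))| * G y := by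
  refine (norm_lap_cornerBlend_le T U W hW1 P m x Z).trans (add_le_add (add_le_add ?_ ?_) ?_)
  · -- group (iii): the frame Laplacians, second-order symmetric-pair row
    rw [Finset.mul_sum]
    refine Finset.sum_le_sum fun y _ => ?_
    by_cases hn : N y x
    · have hdiv : ‖divB T U (fun μ => covD T U μ (fun z => R (P y z) (m y))) x‖ ≤ ∑ _μ : ι, 2 * (a₁ + a₀ ^ 2 + a₀ ^ 2) * ‖m y - c y‖ := by
        show ‖∑ μ, covDstar T U μ (covD T U μ (fun z => R (P y z) (m y))) x‖ ≤ _
        refine (norm_sum_le _ _).trans (Finset.sum_le_sum fun μ _ => ?_)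
        obtain ⟨h1, h2, h3⟩ := hA y x hn μ
        refine (norm_covDstar_covD_conjFrame_le_pair T U (hP y) hU (m y) (c y) (hc y) μ x).trans ?_
        have s1 := pow_le_pow_left₀ (norm_nonneg _) h1 2
        have s2 := pow_le_pow_left₀ (norm_nonneg _) h2 2
        exact mul_le_mul_of_nonneg_right (mul_le_mul_of_nonneg_left (add_le_add (add_le_add h3 s1) s2) (by norm_num)) (norm_nonneg _)
      rw [Finset.sum_const, Finset.card_univ, nsmul_eq_mul] at hdiv
      rw [abs_of_nonneg (hW0 y x)]
      calc W y x * ‖divB T U (fun μ => covD T U μ (fun z => R (P y z) (m y))) x‖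
          ≤ W y x * ((Fintype.card ι : ℝ) * (2 * (a₁ + a₀ ^ 2 + a₀ ^ 2) * ‖m y - c y‖)) := mul_le_mul_of_nonneg_left hdiv (hW0 y x)
        _ = 2 * (Fintype.card ι) * (a₁ + 2 * a₀ ^ 2) * (W y x * ‖m y - c y‖) := by ring
    · rw [(hN y x hn).1]; simp
  · -- group (ii): weight gradients times first-order rows
    rw [Finset.mul_sum]
    refine Finset.sum_le_sum fun y _ => ?_
    rw [Finset.mul_sum]
    refine Finset.sum_le_sum fun μ _ => ?_
    by_cases hn : N y x
    · obtain ⟨h1, h2, -⟩ := hA y x hn μ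
      have b1 := norm_covDstar_conjFrame_le_central T U (hP y) hU (m y) (c y) (hc y) μ x
      have b2 := norm_covD_conjFrame_le_central T U (hP y) hU (m y) (c y) (hc y) μ x
      have n3 := norm_nonneg (m y - c y)
      have c1 : ‖covDstar T U μ (fun z => R (P y z) (m y)) x‖ ≤ 2 * a₀ * ‖m y - c y‖ :=
        b1.trans (mul_le_mul_of_nonneg_right (mul_le_mul_of_nonneg_left h2 (by norm_num)) n3)
      have c2 : ‖covD T U μ (fun z => R (P y z) (m y)) x‖ ≤ 2 * a₀ * ‖m y - c y‖ :=
        b2.trans (mul_le_mul_of_nonneg_right (mul_le_mul_of_nonneg_left h1 (by norm_num)) n3)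
      calc |W y x - W y ((T μ).symm x)| * ‖covDstar T U μ (fun z => R (P y z) (m y)) x‖
            + |W y (T μ x) - W y x| * ‖covD T U μ (fun z => R (P y z) (m y)) x‖
          ≤ |W y x - W y ((T μ).symm x)| * (2 * a₀ * ‖m y - c y‖) + |W y (T μ x) - W y x| * (2 * a₀ * ‖m y - c y‖) :=
            add_le_add (mul_le_mul_of_nonneg_left c1 (abs_nonneg _)) (mul_le_mul_of_nonneg_left c2 (abs_nonneg _))
        _ = 2 * a₀ * ((|W y x - W y ((T μ).symm x)| + |W y (T μ x) - W y x|) * ‖m y - c y‖) := by ring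
    · obtain ⟨h0, hp, hm⟩ := hN y x hn
      rw [h0, hp μ, hm μ]; simp
  · -- group (i): weight second differences times the recentred data
    refine Finset.sum_le_sum fun μ _ => Finset.sum_le_sum fun y _ => ?_
    by_cases hn : N y x
    · exact mul_le_mul_of_nonneg_left (hG y hn μ) (abs_nonneg _)
    · obtain ⟨h0, hp, hm⟩ := hN y x hn
      rw [h0, hp μ, hm μ]; simp

end Rows

/-! ## §4 The energy -/

section Energy

variable {S : Type*} [Fintype S] {ι : Type*} [Fintype ι] (T : ι → Equiv.Perm S) {Y : Type*} [Fintype Y]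

/-- energy of group (iii): `Σ_z (Σ_y W_y(z) b_y)² ≤ K₀·Σ_y b_y²` (Jensen in `y`, column mass `Σ_z W_y ≤ K₀`). [folklore] -/
theorem energy_main (W : Y → S → ℝ) (hW1 : ∀ z : S, ∑ y, W y z = 1) (hW0 : ∀ y z, 0 ≤ W y z) (K₀ : ℝ) (hK0 : ∀ y, ∑ z, W y z ≤ K₀) (b : Y → ℝ) :
    ∑ z, (∑ y, W y z * b y) ^ 2 ≤ K₀ * ∑ y, b y ^ 2 := by
  calc ∑ z, (∑ y, W y z * b y) ^ 2 ≤ ∑ z, ∑ y, W y z * b y ^ 2 := Finset.sum_le_sum fun z _ => jensen_sq _ _ (fun y => hW0 y z) (hW1 z)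
    _ = ∑ y, (∑ z, W y z) * b y ^ 2 := by rw [Finset.sum_comm]; exact Finset.sum_congr rfl fun y _ => by rw [Finset.sum_mul]
    _ ≤ ∑ y, K₀ * b y ^ 2 := Finset.sum_le_sum fun y _ => mul_le_mul_of_nonneg_right (hK0 y) (sq_nonneg _)
    _ = K₀ * ∑ y, b y ^ 2 := by rw [Finset.mul_sum]

/-- energy of group (ii): `Σ_z (Σ_y Σ_μ (|∂⁻_μW_y(z)| + |∂⁺_μW_y(z)|) b_y)² ≤ 4|ι|²G₁K₁·Σ_y b_y²` (weighted Cauchy–Schwarz, `y`-mass `G₁`, column mass `K₁`). [folklore] -/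
theorem energy_grad (W : Y → S → ℝ) (G₁ K₁ : ℝ) (hG₁ : 0 ≤ G₁) (hM1 : ∀ (z : S) (μ : ι), ∑ y, |W y (T μ z) - W y z| ≤ G₁)
    (hK1 : ∀ (y : Y) (μ : ι), ∑ z, |W y (T μ z) - W y z| ≤ K₁) (b : Y → ℝ) :
    ∑ z, (∑ y, ∑ μ, (|W y z - W y ((T μ).symm z)| + |W y (T μ z) - W y z|) * b y) ^ 2
      ≤ 4 * (Fintype.card ι : ℝ) ^ 2 * G₁ * K₁ * ∑ y, b y ^ 2 := by
  have hz : ∀ z : S, (∑ y, ∑ μ, (|W y z - W y ((T μ).symm z)| + |W y (T μ z) - W y z|) * b y) ^ 2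
      ≤ 2 * (Fintype.card ι : ℝ) * G₁ * ∑ y, ∑ μ, (|W y z - W y ((T μ).symm z)| + |W y (T μ z) - W y z|) * b y ^ 2 := by
    intro z
    have cs := wcs2 (fun y μ => |W y z - W y ((T μ).symm z)| + |W y (T μ z) - W y z|) (fun y _ => b y)
      (fun y μ => add_nonneg (abs_nonneg _) (abs_nonneg _))
    have mass : ∑ y, ∑ μ, (|W y z - W y ((T μ).symm z)| + |W y (T μ z) - W y z|) ≤ 2 * (Fintype.card ι : ℝ) * G₁ := by
      rw [Finset.sum_comm]
      have hμ : ∀ μ : ι, ∑ y, (|W y z - W y ((T μ).symm z)| + |W y (T μ z) - W y z|) ≤ G₁ + G₁ := by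
        intro μ
        rw [Finset.sum_add_distrib]
        refine add_le_add ?_ (hM1 z μ)
        have e := hM1 ((T μ).symm z) μ
        simp only [Equiv.apply_symm_apply] at e
        exact e
      calc ∑ μ, ∑ y, (|W y z - W y ((T μ).symm z)| + |W y (T μ z) - W y z|) ≤ ∑ _μ : ι, (G₁ + G₁) := Finset.sum_le_sum fun μ _ => hμ μ
        _ = 2 * (Fintype.card ι : ℝ) * G₁ := by rw [Finset.sum_const, Finset.card_univ, nsmul_eq_mul]; ring
    exact cs.trans (mul_le_mul_of_nonneg_right mass (Finset.sum_nonneg fun y _ => Finset.sum_nonneg fun μ _ =>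
      mul_nonneg (add_nonneg (abs_nonneg _) (abs_nonneg _)) (sq_nonneg _)))
  calc ∑ z, (∑ y, ∑ μ, (|W y z - W y ((T μ).symm z)| + |W y (T μ z) - W y z|) * b y) ^ 2
      ≤ ∑ z, 2 * (Fintype.card ι : ℝ) * G₁ * ∑ y, ∑ μ, (|W y z - W y ((T μ).symm z)| + |W y (T μ z) - W y z|) * b y ^ 2 :=
        Finset.sum_le_sum fun z _ => hz z
    _ = 2 * (Fintype.card ι : ℝ) * G₁ * ∑ y, ∑ μ, (∑ z, (|W y z - W y ((T μ).symm z)| + |W y (T μ z) - W y z|)) * b y ^ 2 := by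
        rw [← Finset.mul_sum]; congr 1
        rw [Finset.sum_comm]; refine Finset.sum_congr rfl fun y _ => ?_
        rw [Finset.sum_comm]; refine Finset.sum_congr rfl fun μ _ => ?_
        rw [Finset.sum_mul]
    _ ≤ 2 * (Fintype.card ι : ℝ) * G₁ * ∑ y, ∑ _μ : ι, (2 * K₁) * b y ^ 2 := by
        refine mul_le_mul_of_nonneg_left (Finset.sum_le_sum fun y _ => Finset.sum_le_sum fun μ _ => mul_le_mul_of_nonneg_right ?_ (sq_nonneg _)) (by positivity)
        rw [Finset.sum_add_distrib]
        refine (add_le_add ?_ (hK1 y μ)).trans (le_of_eq (by ring))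
        rw [← Equiv.sum_comp (T μ) (fun z => |W y z - W y ((T μ).symm z)|)]
        simp only [Equiv.symm_apply_apply]
        exact hK1 y μ
    _ = 4 * (Fintype.card ι : ℝ) ^ 2 * G₁ * K₁ * ∑ y, b y ^ 2 := by
        simp only [Finset.sum_const, Finset.card_univ, nsmul_eq_mul, ← Finset.mul_sum]; ring

/-- energy of group (i): `Σ_z (Σ_μ Σ_y |Δ²_μW_y(z)| G_y)² ≤ |ι|²G₂K₂·Σ_y G_y²`. [folklore] -/
theorem energy_second (W : Y → S → ℝ) (G₂ K₂ : ℝ) (hG₂ : 0 ≤ G₂)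
    (hM2 : ∀ (z : S) (μ : ι), ∑ y, |(W y (T μ z) - W y z) - (W y z - W y ((T μ).symm z))| ≤ G₂)
    (hK2 : ∀ (y : Y) (μ : ι), ∑ z, |(W y (T μ z) - W y z) - (W y z - W y ((T μ).symm z))| ≤ K₂) (G : Y → ℝ) :
    ∑ z, (∑ μ, ∑ y, |(W y (T μ z) - W y z) - (W y z - W y ((T μ).symm z))| * G y) ^ 2
      ≤ (Fintype.card ι : ℝ) ^ 2 * G₂ * K₂ * ∑ y, G y ^ 2 := by
  have hz : ∀ z : S, (∑ μ, ∑ y, |(W y (T μ z) - W y z) - (W y z - W y ((T μ).symm z))| * G y) ^ 2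
      ≤ (Fintype.card ι : ℝ) * G₂ * ∑ μ, ∑ y, |(W y (T μ z) - W y z) - (W y z - W y ((T μ).symm z))| * G y ^ 2 := by
    intro z
    have cs := wcs2 (fun μ y => |(W y (T μ z) - W y z) - (W y z - W y ((T μ).symm z))|) (fun _ y => G y) (fun _ _ => abs_nonneg _)
    have mass : ∑ μ, ∑ y, |(W y (T μ z) - W y z) - (W y z - W y ((T μ).symm z))| ≤ (Fintype.card ι : ℝ) * G₂ :=
      calc ∑ μ, ∑ y, |(W y (T μ z) - W y z) - (W y z - W y ((T μ).symm z))| ≤ ∑ _μ : ι, G₂ := Finset.sum_le_sum fun μ _ => hM2 z μ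
        _ = (Fintype.card ι : ℝ) * G₂ := by rw [Finset.sum_const, Finset.card_univ, nsmul_eq_mul]
    exact cs.trans (mul_le_mul_of_nonneg_right mass (Finset.sum_nonneg fun _ _ => Finset.sum_nonneg fun _ _ => mul_nonneg (abs_nonneg _) (sq_nonneg _)))
  calc ∑ z, (∑ μ, ∑ y, |(W y (T μ z) - W y z) - (W y z - W y ((T μ).symm z))| * G y) ^ 2
      ≤ ∑ z, (Fintype.card ι : ℝ) * G₂ * ∑ μ, ∑ y, |(W y (T μ z) - W y z) - (W y z - W y ((T μ).symm z))| * G y ^ 2 := Finset.sum_le_sum fun z _ => hz z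
    _ = (Fintype.card ι : ℝ) * G₂ * ∑ μ, ∑ y, (∑ z, |(W y (T μ z) - W y z) - (W y z - W y ((T μ).symm z))|) * G y ^ 2 := by
        rw [← Finset.mul_sum]; congr 1
        rw [Finset.sum_comm]; refine Finset.sum_congr rfl fun μ _ => ?_
        rw [Finset.sum_comm]; refine Finset.sum_congr rfl fun y _ => ?_
        rw [Finset.sum_mul]
    _ ≤ (Fintype.card ι : ℝ) * G₂ * ∑ _μ : ι, ∑ y, K₂ * G y ^ 2 :=
        mul_le_mul_of_nonneg_left (Finset.sum_le_sum fun μ _ => Finset.sum_le_sum fun y _ => mul_le_mul_of_nonneg_right (hK2 y μ) (sq_nonneg _)) (by positivity)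
    _ = (Fintype.card ι : ℝ) ^ 2 * G₂ * K₂ * ∑ y, G y ^ 2 := by
        rw [Finset.sum_const, Finset.card_univ, nsmul_eq_mul, ← Finset.mul_sum]; ring

end Energy

section Main

variable {𝔸 : Type} [NormedRing 𝔸] [NormedAlgebra ℝ 𝔸] {S : Type*} [Fintype S] {ι : Type*} [Fintype ι] (T : ι → Equiv.Perm S) (U : ι → S → 𝔸ˣ)
  {Y : Type*} [Fintype Y]

/-- ★★★ **THE LAPLACIAN ENERGY OF THE CORNER BLEND**: with the rows of `norm_lap_cornerBlend_le_rows` uniformly in the site, weight masses in `y` (`G₁`, `G₂`) and in the site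
(`K₀`, `K₁`, `K₂`), `Σ_z ‖Δ_UΦ(z)‖² ≤ [3(2|ι|(a₁ + 2a₀²))²K₀ + 48|ι|²a₀²G₁K₁]·Σ_y‖m_y − c_y‖² + 3|ι|²G₂K₂·Σ_y G_y²`.
[cite: Balaban1985BackgroundPropagators, (3.3)-(3.4) pp.390-391, (3.35) p.396] -/
theorem sum_sq_norm_lap_cornerBlend_le
    (hU : ∀ (κ : ι) (z : S), ‖(U κ z : 𝔸)‖ ≤ 1 ∧ ‖(((U κ z)⁻¹ : 𝔸ˣ) : 𝔸)‖ ≤ 1)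
    (W : Y → S → ℝ) (hW1 : ∀ z : S, ∑ y, W y z = 1) (hW0 : ∀ y z, 0 ≤ W y z)
    (P : Y → S → 𝔸ˣ) (hP : ∀ y z, ‖(P y z : 𝔸)‖ ≤ 1 ∧ ‖(((P y z)⁻¹ : 𝔸ˣ) : 𝔸)‖ ≤ 1)
    (m c : Y → 𝔸) (hc : ∀ y (a : 𝔸), Commute (c y) a)
    (N : Y → S → Prop) (hN : ∀ y z, ¬ N y z → W y z = 0 ∧ (∀ μ, W y (T μ z) = 0) ∧ (∀ μ, W y ((T μ).symm z) = 0))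
    (a₀ a₁ : ℝ)
    (hA : ∀ y z, N y z → ∀ μ, ‖(((P y z)⁻¹ * U μ z * P y (T μ z) : 𝔸ˣ) : 𝔸) - 1‖ ≤ a₀
      ∧ ‖(((P y ((T μ).symm z))⁻¹ * U μ ((T μ).symm z) * P y z : 𝔸ˣ) : 𝔸) - 1‖ ≤ a₀
      ∧ ‖(((P y z)⁻¹ * U μ z * P y (T μ z) : 𝔸ˣ) : 𝔸) - (((P y ((T μ).symm z))⁻¹ * U μ ((T μ).symm z) * P y z : 𝔸ˣ) : 𝔸)‖ ≤ a₁)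
    (Z : ι → S → 𝔸) (G : Y → ℝ) (hG : ∀ y z, N y z → ∀ μ, ‖R (P y z) (m y) - Z μ z‖ ≤ G y)
    (G₁ G₂ K₀ K₁ K₂ : ℝ) (hG₁ : 0 ≤ G₁) (hG₂ : 0 ≤ G₂)
    (hM1 : ∀ (z : S) (μ : ι), ∑ y, |W y (T μ z) - W y z| ≤ G₁)
    (hM2 : ∀ (z : S) (μ : ι), ∑ y, |(W y (T μ z) - W y z) - (W y z - W y ((T μ).symm z))| ≤ G₂)
    (hK0 : ∀ y, ∑ z, W y z ≤ K₀)
    (hK1 : ∀ (y : Y) (μ : ι), ∑ z, |W y (T μ z) - W y z| ≤ K₁)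
    (hK2 : ∀ (y : Y) (μ : ι), ∑ z, |(W y (T μ z) - W y z) - (W y z - W y ((T μ).symm z))| ≤ K₂) :
    ∑ z, ‖divB T U (fun μ => covD T U μ (fun z' => ∑ y, W y z' • R (P y z') (m y))) z‖ ^ 2
      ≤ (3 * (2 * (Fintype.card ι : ℝ) * (a₁ + 2 * a₀ ^ 2)) ^ 2 * K₀ + 48 * (Fintype.card ι : ℝ) ^ 2 * a₀ ^ 2 * G₁ * K₁) * ∑ y, ‖m y - c y‖ ^ 2
        + 3 * (Fintype.card ι : ℝ) ^ 2 * G₂ * K₂ * ∑ y, G y ^ 2 := by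
  have h3 : ∀ a b e : ℝ, (a + b + e) ^ 2 ≤ 3 * (a ^ 2 + b ^ 2 + e ^ 2) := fun a b e => by
    nlinarith [sq_nonneg (a - b), sq_nonneg (b - e), sq_nonneg (a - e)]
  have hpt := fun z : S => norm_lap_cornerBlend_le_rows T U hU W hW1 hW0 P hP m c hc N hN a₀ a₁ hA z (fun μ => Z μ z) G (fun y hn μ => hG y z hn μ)
  have hsq : ∀ z : S, ‖divB T U (fun μ => covD T U μ (fun z' => ∑ y, W y z' • R (P y z') (m y))) z‖ ^ 2
      ≤ 3 * ((2 * (Fintype.card ι : ℝ) * (a₁ + 2 * a₀ ^ 2) * ∑ y, W y z * ‖m y - c y‖) ^ 2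
        + (2 * a₀ * ∑ y, ∑ μ, (|W y z - W y ((T μ).symm z)| + |W y (T μ z) - W y z|) * ‖m y - c y‖) ^ 2
        + (∑ μ, ∑ y, |(W y (T μ z) - W y z) - (W y z - W y ((T μ).symm z))| * G y) ^ 2) :=
    fun z => (pow_le_pow_left₀ (norm_nonneg _) (hpt z) 2).trans (h3 _ _ _)
  have eA := energy_main W hW1 hW0 K₀ hK0 (fun y => ‖m y - c y‖)
  have eB := energy_grad T W G₁ K₁ hG₁ hM1 hK1 (fun y => ‖m y - c y‖)
  have eC := energy_second T W G₂ K₂ hG₂ hM2 hK2 G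
  calc ∑ z, ‖divB T U (fun μ => covD T U μ (fun z' => ∑ y, W y z' • R (P y z') (m y))) z‖ ^ 2
      ≤ ∑ z, 3 * ((2 * (Fintype.card ι : ℝ) * (a₁ + 2 * a₀ ^ 2) * ∑ y, W y z * ‖m y - c y‖) ^ 2
        + (2 * a₀ * ∑ y, ∑ μ, (|W y z - W y ((T μ).symm z)| + |W y (T μ z) - W y z|) * ‖m y - c y‖) ^ 2
        + (∑ μ, ∑ y, |(W y (T μ z) - W y z) - (W y z - W y ((T μ).symm z))| * G y) ^ 2) := Finset.sum_le_sum fun z _ => hsq z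
    _ = 3 * (2 * (Fintype.card ι : ℝ) * (a₁ + 2 * a₀ ^ 2)) ^ 2 * ∑ z, (∑ y, W y z * ‖m y - c y‖) ^ 2
        + 12 * a₀ ^ 2 * ∑ z, (∑ y, ∑ μ, (|W y z - W y ((T μ).symm z)| + |W y (T μ z) - W y z|) * ‖m y - c y‖) ^ 2
        + 3 * ∑ z, (∑ μ, ∑ y, |(W y (T μ z) - W y z) - (W y z - W y ((T μ).symm z))| * G y) ^ 2 := by
        rw [Finset.mul_sum, Finset.mul_sum, Finset.mul_sum, ← Finset.sum_add_distrib, ← Finset.sum_add_distrib]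
        exact Finset.sum_congr rfl fun z _ => by ring
    _ ≤ 3 * (2 * (Fintype.card ι : ℝ) * (a₁ + 2 * a₀ ^ 2)) ^ 2 * (K₀ * ∑ y, ‖m y - c y‖ ^ 2)
        + 12 * a₀ ^ 2 * (4 * (Fintype.card ι : ℝ) ^ 2 * G₁ * K₁ * ∑ y, ‖m y - c y‖ ^ 2)
        + 3 * ((Fintype.card ι : ℝ) ^ 2 * G₂ * K₂ * ∑ y, G y ^ 2) :=
        add_le_add (add_le_add (mul_le_mul_of_nonneg_left eA (by positivity)) (mul_le_mul_of_nonneg_left eB (by positivity)))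
          (mul_le_mul_of_nonneg_left eC (by norm_num))
    _ = (3 * (2 * (Fintype.card ι : ℝ) * (a₁ + 2 * a₀ ^ 2)) ^ 2 * K₀ + 48 * (Fintype.card ι : ℝ) ^ 2 * a₀ ^ 2 * G₁ * K₁) * ∑ y, ‖m y - c y‖ ^ 2
        + 3 * (Fintype.card ι : ℝ) ^ 2 * G₂ * K₂ * ∑ y, G y ^ 2 := by ring

end Main

end Summit.QuantumFields.YangMills.Theorems.Prop7HermiteCornerBlendEnergy

end
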